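import Mathlib
import Summits.AnomalousDissipation.AnomalousDissipation.Theses.DyadicWallCascade
import Summits.AnomalousDissipation.AnomalousDissipation.Theorems.DyadicWallCascadeHalfSpaceHierarchyXIndepSliceTools
import Summits.AnomalousDissipation.AnomalousDissipation.Theorems.DyadicWallCascadeHalfSpaceHierarchyHeadFluxTransport
import Summits.AnomalousDissipation.AnomalousDissipation.Theorems.DyadicWallCascadeHalfSpaceHierarchyOscillatoryIBP
import Summits.AnomalousDissipation.AnomalousDissipation.Theorems.DyadicWallCascadeHalfSpaceHierarchySliceIntegral
import Summits.AnomalousDissipation.AnomalousDissipation.Theorems.HalfSpaceHierarchy.Negative.Reversible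

/-!
# No `x`-independent (2½-D) half-space hierarchy
# (negative lemma for the crux `DyadicWallCascade.HalfSpaceHierarchy`, stmt-AnomalousDissipation-18627)

Line `Sketch`, continuation lead `prover-line-stmt-AnomalousDissipation-18627-c1-0`; Negative lane (D-0016) of
route `DyadicWallCascade` of `Summits/AnomalousDissipation`.

`not_xIndependentHalfSpaceHierarchy`: the crux body (verbatim) together with "`V` and `Q` do not depend on
`x`" (`V (X + t e₀) = V X`, `Q (X + t e₀) = Q X` on the open half-space) is FALSE.  This is the planners'
lemma "2-D is empty" (opener L3, dossier L2) and the disprover's sorried near-miss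
`Cruxes/HalfSpaceHierarchy/Disproof.lean §C not_xIndependentHalfSpaceHierarchy`, whose paper proof used flow
maps, area preservation and a first-return map.  The proof here is NEW and elementary:

1. (`stub_xIndepStreamFunction`, `stub_xIndepSliceTools`) the planar field `(v, w) = (V₁, V₂)(y, z)` has a
   smooth stream function `ψ` on the half-space, `dψ = v dz − w dy`, normalised by the dilation law
   `ψ (2X) = 2 ψ X`; the unit `y`-period of `V` descends to every height `0 < z ≤ 2` and is a period of `ψ`
   up to a constant, which the zero-mass-flux clause kills (`ψ(0,1,1) − ψ(0,0,1) = −∫₀¹ w dy = 0`);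
2. (`stub_headFluxTransport`) the head `B = ‖V‖²/2 + Q` is a first integral (`v B_y + w B_z = 0`, steady
   Euler), so for every `C¹` function `f` the planar field `f(ψ) B (v, w)` is divergence free and Green's
   formula on `[0,1] × [2^{-k}, 1]` gives `∫₀¹ f(ψ) B w dy|_{z=1} = ∫₀¹ f(ψ) B w dy|_{z=2^{-k}}`;
3. at height `2^{-k}` the dilation law gives `|ψ| ≤ M 2^{-k}` (`M` = bound of the periodic trace
   `ψ(0, ·, 1)`), so with `f = cos(·/ε)` the right side tends to `∫₀¹ B w dy = F` (`stub_sliceIntegral`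
   turns both flux clauses into slice integrals): `∫₀¹ cos(ψ/ε) B w dy|_{z=1} = F` for every `ε > 0`;
4. (`stub_oscillatoryIBP`) at `z = 1`, `cos(ψ/ε) w = −ε ∂_y sin(ψ/ε)` and one integration by parts over the
   period gives `|F| ≤ ε ∫₀¹ |∂_y B| dy` for every `ε > 0`, i.e. `F = 0`, against `F ≠ 0`.

Reading for constructions: every witness of the crux depends on BOTH horizontal variables in every
octave; sheet / 2½-D designs (`V = (u, v, w)(y, z)`, with or without the transported third component)
are empty, however the head profile is chosen.
-/

open scoped BigOperators Topology InnerProductSpace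
open Filter Set MeasureTheory

-- `Summit.<Summit>.<Problem>` is the tree's mandated summit-side namespace (CONVENTIONS §2); for this
-- single-conjunct summit the two coincide, so the duplicate is deliberate.
set_option linter.dupNamespace false

namespace Summit.AnomalousDissipation.AnomalousDissipation.Theorems

open HalfSpaceHierarchy HalfSpaceHierarchyNegative in
/-- **No `x`-independent half-space hierarchy** (2½-D no-go): the crux `DyadicWallCascade.HalfSpaceHierarchy`
with the extra clause "`V` and `Q` are invariant under `X ↦ X + t e₀` on the half-space" has no witness.
Stream function + closed forms `f(ψ) B dψ` + Green + dilation decay of `ψ` + oscillatory integration by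
parts, see the module docstring. [folklore] -/
theorem not_xIndependentHalfSpaceHierarchy :
    ¬ (∃ (V : EuclideanSpace ℝ (Fin 3) → EuclideanSpace ℝ (Fin 3)) (Q : EuclideanSpace ℝ (Fin 3) → ℝ) (C F : ℝ),
        (let H : Set (EuclideanSpace ℝ (Fin 3)) := {X | 0 < X 2}
         let e : Fin 3 → EuclideanSpace ℝ (Fin 3) := fun i => EuclideanSpace.single i (1 : ℝ)
         let pt : ℝ × ℝ → EuclideanSpace ℝ (Fin 3) := fun q => !₂[q.1, q.2, (1 : ℝ)]
         ContDiffOn ℝ ((⊤ : ℕ∞) : WithTop ℕ∞) V H ∧ ContDiffOn ℝ ((⊤ : ℕ∞) : WithTop ℕ∞) Q H ∧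
         (∀ X ∈ H, ‖V X‖ ≤ C ∧ |Q X| ≤ C) ∧ (∀ X ∈ H, ∑ i : Fin 3, (fderiv ℝ V X (e i)) i = 0) ∧
         (∀ X ∈ H, (fderiv ℝ V X) (V X) + gradient Q X = 0) ∧
         (∀ X ∈ H, V ((2 : ℝ) • X) = V X ∧ Q ((2 : ℝ) • X) = Q X) ∧
         (∀ X : EuclideanSpace ℝ (Fin 3), 1 ≤ X 2 → X 2 ≤ 2 →
            V (X + e 0) = V X ∧ V (X + e 1) = V X ∧ Q (X + e 0) = Q X ∧ Q (X + e 1) = Q X) ∧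
         (∫ q in Set.Icc (0 : ℝ) 1 ×ˢ Set.Icc (0 : ℝ) 1, (V (pt q)) 2 = 0) ∧ F ≠ 0 ∧
         (∫ q in Set.Icc (0 : ℝ) 1 ×ˢ Set.Icc (0 : ℝ) 1, (V (pt q)) 2 * (‖V (pt q)‖ ^ 2 / 2 + Q (pt q)) = F)) ∧
        (∀ (X : EuclideanSpace ℝ (Fin 3)) (t : ℝ), 0 < X 2 →
            V (X + t • EuclideanSpace.single 0 (1 : ℝ)) = V X ∧ Q (X + t • EuclideanSpace.single 0 (1 : ℝ)) = Q X)) := by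
  rintro ⟨V, Q, C, F, hbody, hx⟩
  simp only at hbody
  obtain ⟨hVs, hQs, hbdd, hdiv, hEul, hdil, hper, hmass, hF, hflux⟩ := hbody
  -- notation
  set e₀ : EuclideanSpace ℝ (Fin 3) := EuclideanSpace.single 0 (1 : ℝ) with he₀
  set e₁ : EuclideanSpace ℝ (Fin 3) := EuclideanSpace.single 1 (1 : ℝ) with he₁
  set e₂ : EuclideanSpace ℝ (Fin 3) := EuclideanSpace.single 2 (1 : ℝ) with he₂
  have hHo : IsOpen {X : EuclideanSpace ℝ (Fin 3) | 0 < X 2} := isOpen_halfSpace_coord_two_pos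
  have htop : ((⊤ : ℕ∞) : WithTop ℕ∞) ≠ 0 := by simp
  have hVd : ∀ X : EuclideanSpace ℝ (Fin 3), 0 < X 2 → DifferentiableAt ℝ V X := fun X hX =>
    (hVs.differentiableOn htop).differentiableAt (hHo.mem_nhds hX)
  have hQd : ∀ X : EuclideanSpace ℝ (Fin 3), 0 < X 2 → DifferentiableAt ℝ Q X := fun X hX =>
    (hQs.differentiableOn htop).differentiableAt (hHo.mem_nhds hX)
  -- x-invariance, dilation, periods
  have hxV : ∀ X : EuclideanSpace ℝ (Fin 3), 0 < X 2 → ∀ t : ℝ, V (X + t • e₀) = V X :=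
    fun X hX t => (hx X t hX).1
  have hxQ : ∀ X : EuclideanSpace ℝ (Fin 3), 0 < X 2 → ∀ t : ℝ, Q (X + t • e₀) = Q X :=
    fun X hX t => (hx X t hX).2
  have hV0 : ∀ X : EuclideanSpace ℝ (Fin 3), 0 < X 2 → fderiv ℝ V X e₀ = 0 := fun X hX =>
    xIndep_fderiv_single_zero_of_invariant V (hVd X hX) (hxV X hX)
  have hdilV : ∀ X : EuclideanSpace ℝ (Fin 3), 0 < X 2 → V ((2 : ℝ) • X) = V X := fun X hX => (hdil X hX).1
  have hdilQ : ∀ X : EuclideanSpace ℝ (Fin 3), 0 < X 2 → Q ((2 : ℝ) • X) = Q X := fun X hX => (hdil X hX).2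
  have hperV : ∀ X : EuclideanSpace ℝ (Fin 3), 0 < X 2 → X 2 ≤ 2 → V (X + e₁) = V X :=
    xIndep_periodic_of_le_two V (by simp [he₁]) hdilV fun X h1 h2 => (hper X h1 h2).2.1
  have hperQ : ∀ X : EuclideanSpace ℝ (Fin 3), 0 < X 2 → X 2 ≤ 2 → Q (X + e₁) = Q X :=
    xIndep_periodic_of_le_two Q (by simp [he₁]) hdilQ fun X h1 h2 => (hper X h1 h2).2.2.2
  -- the normalised stream function and its period
  obtain ⟨ψ, hψs, hψd, hψdil⟩ := xIndep_exists_normalised_streamFunction V hVs hxV hdiv hdilV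
  obtain ⟨c, hc⟩ := xIndep_streamFunction_period V ψ hψd (v := e₁) (by simp [he₁]) hperV
  -- the head and its derivative
  set B : EuclideanSpace ℝ (Fin 3) → ℝ := fun Y => ‖V Y‖ ^ 2 / 2 + Q Y with hB
  have hBs : ContDiffOn ℝ ((⊤ : ℕ∞) : WithTop ℕ∞) B {X : EuclideanSpace ℝ (Fin 3) | 0 < X 2} :=
    ((hVs.norm_sq (𝕜 := ℝ)).div_const 2).add hQs
  have hBt := fun (X : EuclideanSpace ℝ (Fin 3)) (hX : 0 < X 2) =>
    xIndep_bernoulli_transport (hVd X hX) (hQd X hX) (hEul X hX)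
  -- slice points
  have hsl2 : ∀ q : ℝ × ℝ, ((!₂[(0 : ℝ), q.1, q.2] : EuclideanSpace ℝ (Fin 3))) 2 = q.2 := fun q => by simp
  have hsl_e1 : ∀ z : ℝ, (!₂[(0 : ℝ), (1 : ℝ), z] : EuclideanSpace ℝ (Fin 3)) = !₂[(0 : ℝ), (0 : ℝ), z] + e₁ := by
    intro z; ext i; fin_cases i <;> simp [he₁]
  have hpt_e0 : ∀ q : ℝ × ℝ, (!₂[q.1, q.2, (1 : ℝ)] : EuclideanSpace ℝ (Fin 3)) = !₂[(0 : ℝ), q.2, (1 : ℝ)] + q.1 • e₀ := by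
    intro q; ext i; fin_cases i <;> simp [he₀]
  have hVpt : ∀ q : ℝ × ℝ, V !₂[q.1, q.2, (1 : ℝ)] = V !₂[(0 : ℝ), q.2, (1 : ℝ)] := by
    intro q; rw [hpt_e0 q]; exact hxV _ (by simp) _
  have hQpt : ∀ q : ℝ × ℝ, Q !₂[q.1, q.2, (1 : ℝ)] = Q !₂[(0 : ℝ), q.2, (1 : ℝ)] := by
    intro q; rw [hpt_e0 q]; exact hxQ _ (by simp) _
  -- slice forms of the two flux clauses
  have hcontV1 : Continuous fun q : ℝ × ℝ => V !₂[q.1, q.2, (1 : ℝ)] :=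
    hVs.continuousOn.comp_continuous continuous_pt (fun q => by simp)
  have hcontQ1 : Continuous fun q : ℝ × ℝ => Q !₂[q.1, q.2, (1 : ℝ)] :=
    hQs.continuousOn.comp_continuous continuous_pt (fun q => by simp)
  have hmass1 : ∫ y in (0 : ℝ)..1, (V !₂[(0 : ℝ), y, (1 : ℝ)]) 2 = 0 := by
    have h := stub_sliceIntegral (fun q : ℝ × ℝ => (V !₂[q.1, q.2, (1 : ℝ)]) 2)
      ((EuclideanSpace.proj (2 : Fin 3)).continuous.comp hcontV1) (fun q => by simp only [hVpt q])
    rw [hmass] at h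
    simpa using h.symm
  have hflux1 : ∫ y in (0 : ℝ)..1, (V !₂[(0 : ℝ), y, (1 : ℝ)]) 2 * B !₂[(0 : ℝ), y, (1 : ℝ)] = F := by
    have h := stub_sliceIntegral
      (fun q : ℝ × ℝ => (V !₂[q.1, q.2, (1 : ℝ)]) 2 * (‖V !₂[q.1, q.2, (1 : ℝ)]‖ ^ 2 / 2 + Q !₂[q.1, q.2, (1 : ℝ)]))
      ((((EuclideanSpace.proj (2 : Fin 3)).continuous.comp hcontV1)).mul
        (((hcontV1.norm.pow 2).div_const 2).add hcontQ1))
      (fun q => by simp only [hVpt q, hQpt q])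
    rw [hflux] at h
    simpa [hB] using h.symm
  -- the period constant of ψ vanishes (zero mass flux)
  have hψline : ∀ r : ℝ, HasDerivAt (fun s : ℝ => ψ !₂[(0 : ℝ), s, (1 : ℝ)])
      (-(V !₂[(0 : ℝ), r, (1 : ℝ)]) 2) r := by
    intro r
    have h := xIndep_hasDerivAt_line_comp ψ (hψd (!₂[(0 : ℝ), r, (1 : ℝ)]) (by simp))
    simpa [he₁] using h
  have hVline : Continuous fun s : ℝ => V !₂[(0 : ℝ), s, (1 : ℝ)] :=
    (xIndep_contDiff_line_comp V one_pos hVs).continuous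
  have hwline : Continuous fun s : ℝ => (V !₂[(0 : ℝ), s, (1 : ℝ)]) 2 :=
    slabExt_continuous_height.comp hVline
  have hc0 : c = 0 := by
    have hint := intervalIntegral.integral_eq_sub_of_hasDerivAt
      (fun r (_ : r ∈ Set.uIcc (0 : ℝ) 1) => hψline r) (hwline.neg.intervalIntegrable 0 1)
    have h1 : ψ !₂[(0 : ℝ), (1 : ℝ), (1 : ℝ)] = ψ !₂[(0 : ℝ), (0 : ℝ), (1 : ℝ)] + c := by
      rw [hsl_e1 1]; exact hc _ (by simp) (by simp)
    rw [intervalIntegral.integral_neg, hmass1, h1] at hint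
    linarith
  have hψper : ∀ X : EuclideanSpace ℝ (Fin 3), 0 < X 2 → X 2 < 2 → ψ (X + e₁) = ψ X := by
    intro X h1 h2; rw [hc X h1 h2, hc0, add_zero]
  -- §7 planar data on the slice `x = 0`
  set ψ₂ : ℝ × ℝ → ℝ := fun q => ψ !₂[(0 : ℝ), q.1, q.2] with hψ₂
  set b₂ : ℝ × ℝ → ℝ := fun q => B !₂[(0 : ℝ), q.1, q.2] with hb₂
  set v₂ : ℝ × ℝ → ℝ := fun q => (V !₂[(0 : ℝ), q.1, q.2]) 1 with hv₂
  set w₂ : ℝ × ℝ → ℝ := fun q => (V !₂[(0 : ℝ), q.1, q.2]) 2 with hw₂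
  have hVis : ∀ i : Fin 3, ContDiffOn ℝ ((⊤ : ℕ∞) : WithTop ℕ∞) (fun Y => V Y i)
      {X : EuclideanSpace ℝ (Fin 3) | 0 < X 2} := contDiffOn_euclidean.1 hVs
  have hψ₂s : ContDiffOn ℝ 1 ψ₂ {p : ℝ × ℝ | 0 < p.2} := (xIndep_contDiffOn_slice_comp ψ hψs).of_le (by exact_mod_cast le_top)
  have hb₂s : ContDiffOn ℝ 1 b₂ {p : ℝ × ℝ | 0 < p.2} := (xIndep_contDiffOn_slice_comp B hBs).of_le (by exact_mod_cast le_top)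
  have hv₂s : ContDiffOn ℝ 1 v₂ {p : ℝ × ℝ | 0 < p.2} :=
    (xIndep_contDiffOn_slice_comp (fun Y => V Y 1) (hVis 1)).of_le (by exact_mod_cast le_top)
  have hw₂s : ContDiffOn ℝ 1 w₂ {p : ℝ × ℝ | 0 < p.2} :=
    (xIndep_contDiffOn_slice_comp (fun Y => V Y 2) (hVis 2)).of_le (by exact_mod_cast le_top)
  have hslpos : ∀ p : ℝ × ℝ, 0 < p.2 → 0 < (!₂[(0 : ℝ), p.1, p.2] : EuclideanSpace ℝ (Fin 3)) 2 :=
    fun p hp => by simpa using hp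
  -- (b1) stream-function relations
  have hrel1 : ∀ p : ℝ × ℝ, 0 < p.2 → fderiv ℝ ψ₂ p (1, 0) = - w₂ p ∧ fderiv ℝ ψ₂ p (0, 1) = v₂ p := by
    intro p hp
    have h := xIndep_fderiv_slice_comp_apply ψ (hψd _ (hslpos p hp))
    refine ⟨?_, ?_⟩
    · rw [hψ₂, h.1]; simp [hw₂]
    · rw [hψ₂, h.2]; simp [hv₂]
  -- (b2) planar divergence
  have hrel2 : ∀ p : ℝ × ℝ, 0 < p.2 → fderiv ℝ v₂ p (1, 0) + fderiv ℝ w₂ p (0, 1) = 0 := by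
    intro p hp
    have hX := hslpos p hp
    have hV1 : HasFDerivAt (fun Y => V Y 1)
        ((EuclideanSpace.proj (1 : Fin 3) : EuclideanSpace ℝ (Fin 3) →L[ℝ] ℝ).comp (fderiv ℝ V _)) _ :=
      (EuclideanSpace.proj (1 : Fin 3) : EuclideanSpace ℝ (Fin 3) →L[ℝ] ℝ).hasFDerivAt.comp _ (hVd _ hX).hasFDerivAt
    have hV2 : HasFDerivAt (fun Y => V Y 2)
        ((EuclideanSpace.proj (2 : Fin 3) : EuclideanSpace ℝ (Fin 3) →L[ℝ] ℝ).comp (fderiv ℝ V _)) _ :=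
      (EuclideanSpace.proj (2 : Fin 3) : EuclideanSpace ℝ (Fin 3) →L[ℝ] ℝ).hasFDerivAt.comp _ (hVd _ hX).hasFDerivAt
    have h1 := (xIndep_fderiv_slice_comp_apply (fun Y => V Y 1) hV1).1
    have h2 := (xIndep_fderiv_slice_comp_apply (fun Y => V Y 2) hV2).2
    rw [hv₂, hw₂, h1, h2]
    have hd := hdiv _ hX
    rw [Fin.sum_univ_three] at hd
    have h0 := hV0 _ hX
    rw [he₀] at h0
    rw [h0] at hd
    simpa using hd
  -- (b3) Bernoulli transport in the plane
  have hrel3 : ∀ p : ℝ × ℝ, 0 < p.2 → v₂ p * fderiv ℝ b₂ p (1, 0) + w₂ p * fderiv ℝ b₂ p (0, 1) = 0 := by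
    intro p hp
    have hX := hslpos p hp
    obtain ⟨hBd, hBV⟩ := hBt _ hX
    have h := xIndep_fderiv_slice_comp_apply (fun Y => ‖V Y‖ ^ 2 / 2 + Q Y) hBd
    rw [hb₂, hv₂, hw₂]
    simp only [hB]
    rw [h.1, h.2]
    -- `∂ₓ B = 0`
    have hBx : ∀ t : ℝ, B (!₂[(0 : ℝ), p.1, p.2] + t • e₀) = B !₂[(0 : ℝ), p.1, p.2] := fun t => by
      simp only [hB, hxV _ hX t, hxQ _ hX t]
    have hB0 : fderiv ℝ B (!₂[(0 : ℝ), p.1, p.2]) e₀ = 0 :=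
      xIndep_fderiv_single_zero_of_invariant B hBd.differentiableAt hBx
    rw [hB, hBd.fderiv] at hB0
    -- decompose `V X` in the basis
    have hdec : V !₂[(0 : ℝ), p.1, p.2] = ((V !₂[(0 : ℝ), p.1, p.2]) 0) • e₀ +
        ((V !₂[(0 : ℝ), p.1, p.2]) 1) • e₁ + ((V !₂[(0 : ℝ), p.1, p.2]) 2) • e₂ := by
      ext i; fin_cases i <;> simp [he₀, he₁, he₂]
    have key : ((1 / 2 : ℝ) • (2 • (innerSL ℝ (V !₂[(0 : ℝ), p.1, p.2])).comp
        (fderiv ℝ V !₂[(0 : ℝ), p.1, p.2])) + fderiv ℝ Q !₂[(0 : ℝ), p.1, p.2])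
        (((V !₂[(0 : ℝ), p.1, p.2]) 0) • e₀ + ((V !₂[(0 : ℝ), p.1, p.2]) 1) • e₁ +
          ((V !₂[(0 : ℝ), p.1, p.2]) 2) • e₂) = 0 := by
      rw [← hdec]; exact hBV
    rw [map_add, map_add, map_smul, map_smul, map_smul, hB0, smul_zero, zero_add, smul_eq_mul, smul_eq_mul,
      he₁, he₂] at key
    exact key
  -- (c) unit periods in `y` on `0 < z ≤ 1`
  have hrel4 : ∀ z : ℝ, 0 < z → z ≤ 1 →
      ψ₂ (1, z) = ψ₂ (0, z) ∧ b₂ (1, z) = b₂ (0, z) ∧ v₂ (1, z) = v₂ (0, z) := by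
    intro z hz hz1
    have h0 : 0 < (!₂[(0 : ℝ), (0 : ℝ), z] : EuclideanSpace ℝ (Fin 3)) 2 := by simpa using hz
    have h2 : (!₂[(0 : ℝ), (0 : ℝ), z] : EuclideanSpace ℝ (Fin 3)) 2 ≤ 2 := by simp; linarith
    have h2' : (!₂[(0 : ℝ), (0 : ℝ), z] : EuclideanSpace ℝ (Fin 3)) 2 < 2 := by simp; linarith
    simp only [hψ₂, hb₂, hv₂, hB]
    rw [hsl_e1 z, hψper _ h0 h2', hperV _ h0 h2, hperQ _ h0 h2]
    exact ⟨rfl, rfl, rfl⟩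
  -- §8 Green transport to the dyadic heights `(2^k)⁻¹`
  have hhk : ∀ k : ℕ, (0 : ℝ) < ((2 : ℝ) ^ k)⁻¹ ∧ ((2 : ℝ) ^ k)⁻¹ ≤ 1 := fun k =>
    ⟨by positivity, inv_le_one_of_one_le₀ (one_le_pow₀ (by norm_num))⟩
  have htrans : ∀ f : ℝ → ℝ, ContDiff ℝ 1 f → ∀ k : ℕ,
      ∫ y in (0 : ℝ)..1, f (ψ₂ (y, 1)) * b₂ (y, 1) * w₂ (y, 1) =
        ∫ y in (0 : ℝ)..1, f (ψ₂ (y, ((2 : ℝ) ^ k)⁻¹)) * b₂ (y, ((2 : ℝ) ^ k)⁻¹) * w₂ (y, ((2 : ℝ) ^ k)⁻¹) :=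
    fun f hf k => stub_headFluxTransport ψ₂ b₂ v₂ w₂ f _ (hhk k).1 (hhk k).2 hf hψ₂s hb₂s hv₂s hw₂s
      hrel1 hrel2 hrel3 hrel4
  -- §9 the energy flux at every dyadic height
  have hflux2 : ∫ y in (0 : ℝ)..1, b₂ (y, 1) * w₂ (y, 1) = F := by
    rw [← hflux1]
    refine intervalIntegral.integral_congr fun y _ => ?_
    simp only [hb₂, hw₂]; ring
  have hfluxk : ∀ k : ℕ, ∫ y in (0 : ℝ)..1, b₂ (y, ((2 : ℝ) ^ k)⁻¹) * w₂ (y, ((2 : ℝ) ^ k)⁻¹) = F := by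
    intro k
    have h1 := htrans (fun _ : ℝ => (1 : ℝ)) contDiff_const k
    simp only [one_mul] at h1
    rw [← h1]; exact hflux2
  -- §10 decay of `ψ` at the dyadic heights
  have hψ1cont : Continuous fun s : ℝ => ψ !₂[(0 : ℝ), s, (1 : ℝ)] :=
    (xIndep_contDiff_line_comp ψ one_pos hψs).continuous
  have hline_e1 : ∀ s : ℝ, (!₂[(0 : ℝ), s + 1, (1 : ℝ)] : EuclideanSpace ℝ (Fin 3)) = !₂[(0 : ℝ), s, (1 : ℝ)] + e₁ := by
    intro s; ext i; fin_cases i <;> simp [he₁]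
  obtain ⟨M, hM⟩ := xIndep_periodic_bound (fun s : ℝ => ψ !₂[(0 : ℝ), s, (1 : ℝ)]) hψ1cont (fun s => by
    show ψ !₂[(0 : ℝ), s + 1, (1 : ℝ)] = ψ !₂[(0 : ℝ), s, (1 : ℝ)]
    rw [hline_e1 s]; exact hψper _ (by simp) (by simp))
  have hM0 : 0 ≤ M := (abs_nonneg _).trans (hM 0)
  have hdecay : ∀ (k : ℕ) (y : ℝ), |ψ₂ (y, ((2 : ℝ) ^ k)⁻¹)| ≤ M * ((2 : ℝ) ^ k)⁻¹ := by
    intro k y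
    simp only [hψ₂]
    have hpk : (0 : ℝ) < (2 : ℝ) ^ k := by positivity
    have hX : 0 < (!₂[(0 : ℝ), y, ((2 : ℝ) ^ k)⁻¹] : EuclideanSpace ℝ (Fin 3)) 2 := by simp
    have h := xIndep_dilate_pow_fun ψ hψdil k _ hX
    have e : ((2 : ℝ) ^ k • (!₂[(0 : ℝ), y, ((2 : ℝ) ^ k)⁻¹] : EuclideanSpace ℝ (Fin 3))) =
        !₂[(0 : ℝ), (2 : ℝ) ^ k * y, (1 : ℝ)] := by
      ext i; fin_cases i <;> simp
    rw [e] at h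
    have h' : ψ !₂[(0 : ℝ), y, ((2 : ℝ) ^ k)⁻¹] = ((2 : ℝ) ^ k)⁻¹ * ψ !₂[(0 : ℝ), (2 : ℝ) ^ k * y, (1 : ℝ)] := by
      rw [h]; field_simp
    rw [h', abs_mul, abs_inv, abs_of_pos hpk, mul_comm]
    exact mul_le_mul_of_nonneg_right (hM _) (by positivity)
  -- bounds for the head and the vertical velocity
  have hC0 : 0 ≤ C := (norm_nonneg _).trans (hbdd (EuclideanSpace.single 2 (1 : ℝ)) (by simp)).1
  have hbw : ∀ X : EuclideanSpace ℝ (Fin 3), 0 < X 2 → |B X * V X 2| ≤ (C ^ 2 / 2 + C) * C := by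
    intro X hX
    obtain ⟨hVb, hQb⟩ := hbdd X hX
    have h2 : |V X 2| ≤ C := by
      have := PiLp.norm_apply_le (V X) 2
      simp only [Real.norm_eq_abs] at this
      exact this.trans hVb
    have hB' : |B X| ≤ C ^ 2 / 2 + C := by
      simp only [hB]
      refine (abs_add_le _ _).trans ?_
      have : |‖V X‖ ^ 2 / 2| = ‖V X‖ ^ 2 / 2 := abs_of_nonneg (by positivity)
      rw [this]
      have : ‖V X‖ ^ 2 ≤ C ^ 2 := pow_le_pow_left₀ (norm_nonneg _) hVb 2
      linarith
    rw [abs_mul]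
    exact mul_le_mul hB' h2 (abs_nonneg _) (by positivity)
  -- §11 the oscillatory head flux at `z = 1` equals `F`
  have hlim0 : Tendsto (fun k : ℕ => ((2 : ℝ) ^ k)⁻¹) atTop (𝓝 0) :=
    (tendsto_inv_atTop_zero.comp (tendsto_pow_atTop_atTop_of_one_lt (one_lt_two : (1 : ℝ) < 2))).congr
      fun _ => rfl
  have hJ : ∀ ε : ℝ, 0 < ε →
      ∫ y in (0 : ℝ)..1, Real.cos (ψ₂ (y, 1) / ε) * b₂ (y, 1) * w₂ (y, 1) = F := by
    intro ε hε
    have hcosd : ContDiff ℝ 1 (fun s : ℝ => Real.cos (s / ε)) := by fun_prop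
    set J := ∫ y in (0 : ℝ)..1, Real.cos (ψ₂ (y, 1) / ε) * b₂ (y, 1) * w₂ (y, 1) with hJdef
    have hK : ∀ k : ℕ, |J - F| ≤ ((M * ((2 : ℝ) ^ k)⁻¹ / ε) ^ 2 / 2) * ((C ^ 2 / 2 + C) * C) := by
      intro k
      obtain ⟨hk0, hk1⟩ := hhk k
      set h : ℝ := ((2 : ℝ) ^ k)⁻¹ with hh
      -- continuity along the line `z = h`
      have hcψ : Continuous fun y : ℝ => ψ₂ (y, h) := by
        simp only [hψ₂]; exact (xIndep_contDiff_line_comp ψ hk0 hψs).continuous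
      have hcb : Continuous fun y : ℝ => b₂ (y, h) := by
        simp only [hb₂]; exact (xIndep_contDiff_line_comp B hk0 hBs).continuous
      have hcw : Continuous fun y : ℝ => w₂ (y, h) := by
        simp only [hw₂]; exact slabExt_continuous_height.comp (xIndep_contDiff_line_comp V hk0 hVs).continuous
      have hi1 : IntervalIntegrable (fun y : ℝ => Real.cos (ψ₂ (y, h) / ε) * b₂ (y, h) * w₂ (y, h)) volume 0 1 :=
        (((Real.continuous_cos.comp (hcψ.div_const ε)).mul hcb).mul hcw).intervalIntegrable 0 1
      have hi2 : IntervalIntegrable (fun y : ℝ => b₂ (y, h) * w₂ (y, h)) volume 0 1 :=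
        (hcb.mul hcw).intervalIntegrable 0 1
      have hdiff : J - F = ∫ y in (0 : ℝ)..1,
          (Real.cos (ψ₂ (y, h) / ε) - 1) * (b₂ (y, h) * w₂ (y, h)) := by
        rw [hJdef, htrans _ hcosd k, ← hfluxk k, ← hh, ← intervalIntegral.integral_sub hi1 hi2]
        refine intervalIntegral.integral_congr fun y _ => ?_
        ring
      rw [hdiff]
      have hbound : ∀ y ∈ Set.uIoc (0 : ℝ) 1,
          ‖(Real.cos (ψ₂ (y, h) / ε) - 1) * (b₂ (y, h) * w₂ (y, h))‖ ≤
            ((M * h / ε) ^ 2 / 2) * ((C ^ 2 / 2 + C) * C) := by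
        intro y _
        rw [Real.norm_eq_abs, abs_mul]
        have hcos : |Real.cos (ψ₂ (y, h) / ε) - 1| ≤ (M * h / ε) ^ 2 / 2 := by
          have h1 := Real.one_sub_sq_div_two_le_cos (x := ψ₂ (y, h) / ε)
          have h2 := Real.cos_le_one (ψ₂ (y, h) / ε)
          rw [abs_of_nonpos (by linarith)]
          have h3 : (ψ₂ (y, h) / ε) ^ 2 ≤ (M * h / ε) ^ 2 := by
            rw [← sq_abs, abs_div, abs_of_pos hε]
            exact pow_le_pow_left₀ (by positivity) (div_le_div_of_nonneg_right (hdecay k y) hε.le) 2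
          linarith
        have hbw' : |b₂ (y, h) * w₂ (y, h)| ≤ (C ^ 2 / 2 + C) * C := by
          simp only [hb₂, hw₂]
          exact hbw _ (by simpa using hk0)
        exact mul_le_mul hcos hbw' (abs_nonneg _) (by positivity)
      have := intervalIntegral.norm_integral_le_of_norm_le_const hbound
      simpa [Real.norm_eq_abs] using this
    have hlim : Tendsto (fun k : ℕ => ((M * ((2 : ℝ) ^ k)⁻¹ / ε) ^ 2 / 2) * ((C ^ 2 / 2 + C) * C))
        atTop (𝓝 0) := by
      have := ((((hlim0.const_mul M).div_const ε).pow 2).div_const 2).mul_const ((C ^ 2 / 2 + C) * C)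
      simpa using this
    have hle : |J - F| ≤ 0 := ge_of_tendsto' hlim hK
    have := abs_nonpos_iff.1 hle
    linarith
  -- §12 integration by parts at `z = 1`
  set ψ₁ : ℝ → ℝ := fun s => ψ !₂[(0 : ℝ), s, (1 : ℝ)] with hψ₁
  set b₁ : ℝ → ℝ := fun s => B !₂[(0 : ℝ), s, (1 : ℝ)] with hb₁
  have hψ₁s : ContDiff ℝ 1 ψ₁ := (xIndep_contDiff_line_comp ψ one_pos hψs).of_le (by exact_mod_cast le_top)
  have hb₁s : ContDiff ℝ 1 b₁ := (xIndep_contDiff_line_comp B one_pos hBs).of_le (by exact_mod_cast le_top)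
  have hψ₁p : ψ₁ 1 = ψ₁ 0 := by
    simp only [hψ₁]; rw [hsl_e1 1]; exact hψper _ (by simp) (by simp)
  have hb₁p : b₁ 1 = b₁ 0 := by
    simp only [hb₁, hB]; rw [hsl_e1 1, hperV _ (by simp) (by simp), hperQ _ (by simp) (by simp)]
  have hderiv : ∀ y : ℝ, deriv ψ₁ y = -(V !₂[(0 : ℝ), y, (1 : ℝ)]) 2 := fun y => (hψline y).deriv
  set K₀ : ℝ := ∫ y in (0 : ℝ)..1, |deriv b₁ y| with hK₀
  have hK₀0 : 0 ≤ K₀ := intervalIntegral.integral_nonneg zero_le_one fun y _ => abs_nonneg _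
  have key : ∀ ε : ℝ, 0 < ε → |F| ≤ ε * K₀ := by
    intro ε hε
    have hibp := stub_oscillatoryIBP ψ₁ b₁ ε hε hψ₁s hb₁s hψ₁p hb₁p
    have hJ' : ∫ y in (0 : ℝ)..1, Real.cos (ψ₂ (y, 1) / ε) * b₂ (y, 1) * w₂ (y, 1) =
        -∫ y in (0 : ℝ)..1, Real.cos (ψ₁ y / ε) * b₁ y * deriv ψ₁ y := by
      rw [← intervalIntegral.integral_neg]
      refine intervalIntegral.integral_congr fun y _ => ?_
      rw [hderiv y]
      simp only [hψ₂, hb₂, hw₂, hψ₁, hb₁]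
      ring
    rw [hJ ε hε] at hJ'
    rw [hJ', abs_neg]
    exact hibp
  -- conclusion: `F = 0`
  have hFpos : 0 < |F| := abs_pos.2 hF
  have h := key (|F| / (2 * (K₀ + 1))) (by positivity)
  have h' : |F| / (2 * (K₀ + 1)) * K₀ ≤ |F| / 2 := by
    rw [div_mul_eq_mul_div, div_le_div_iff₀ (by positivity) (by positivity)]
    nlinarith
  linarith

/-- **Registered stub `stub_notXIndependent` (line `Sketch`, c1)** — the let-free form of
`not_xIndependentHalfSpaceHierarchy`, verbatim as registered on the crux item. [folklore] -/
theorem HalfSpaceHierarchy.stub_notXIndependent :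
    ¬ (∃ (V : EuclideanSpace ℝ (Fin 3) → EuclideanSpace ℝ (Fin 3)) (Q : EuclideanSpace ℝ (Fin 3) → ℝ) (C F : ℝ),
        (ContDiffOn ℝ ((⊤ : ℕ∞) : WithTop ℕ∞) V {X : EuclideanSpace ℝ (Fin 3) | 0 < X 2} ∧
         ContDiffOn ℝ ((⊤ : ℕ∞) : WithTop ℕ∞) Q {X : EuclideanSpace ℝ (Fin 3) | 0 < X 2} ∧
         (∀ X ∈ {X : EuclideanSpace ℝ (Fin 3) | 0 < X 2}, ‖V X‖ ≤ C ∧ |Q X| ≤ C) ∧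
         (∀ X ∈ {X : EuclideanSpace ℝ (Fin 3) | 0 < X 2},
            ∑ i : Fin 3, (fderiv ℝ V X (EuclideanSpace.single i (1 : ℝ))) i = 0) ∧
         (∀ X ∈ {X : EuclideanSpace ℝ (Fin 3) | 0 < X 2}, (fderiv ℝ V X) (V X) + gradient Q X = 0) ∧
         (∀ X ∈ {X : EuclideanSpace ℝ (Fin 3) | 0 < X 2}, V ((2 : ℝ) • X) = V X ∧ Q ((2 : ℝ) • X) = Q X) ∧
         (∀ X : EuclideanSpace ℝ (Fin 3), 1 ≤ X 2 → X 2 ≤ 2 →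
            V (X + EuclideanSpace.single 0 (1 : ℝ)) = V X ∧ V (X + EuclideanSpace.single 1 (1 : ℝ)) = V X ∧
            Q (X + EuclideanSpace.single 0 (1 : ℝ)) = Q X ∧ Q (X + EuclideanSpace.single 1 (1 : ℝ)) = Q X) ∧
         (∫ q in Set.Icc (0 : ℝ) 1 ×ˢ Set.Icc (0 : ℝ) 1, (V !₂[q.1, q.2, (1 : ℝ)]) 2 = 0) ∧ F ≠ 0 ∧
         (∫ q in Set.Icc (0 : ℝ) 1 ×ˢ Set.Icc (0 : ℝ) 1,
            (V !₂[q.1, q.2, (1 : ℝ)]) 2 * (‖V !₂[q.1, q.2, (1 : ℝ)]‖ ^ 2 / 2 + Q !₂[q.1, q.2, (1 : ℝ)]) = F)) ∧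
        (∀ (X : EuclideanSpace ℝ (Fin 3)) (t : ℝ), 0 < X 2 →
            V (X + t • EuclideanSpace.single 0 (1 : ℝ)) = V X ∧ Q (X + t • EuclideanSpace.single 0 (1 : ℝ)) = Q X)) :=
  fun ⟨V, Q, C, F, h, hx⟩ => not_xIndependentHalfSpaceHierarchy ⟨V, Q, C, F, h, hx⟩

end Summit.AnomalousDissipation.AnomalousDissipation.Theorems
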